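import Summits.BirchSwinnertonDyer.BirchSwinnertonDyer.Theses.SignedBaseChange
import HarnessLib

/-!
# RUNG-A for K1 of route SignedBaseChange (BC5 / T3 witness of weakness, sibling setting; supports item stmt-BirchSwinnertonDyer-20249)

K1 = `Summit.BirchSwinnertonDyer.BirchSwinnertonDyer.Theses.SignedBaseChange.TwistPairGreenbergProductDivisibility`
asserts, for an X7 pair `(W, p)` (additive reduction somewhere, `p ≥ 5` supersingular, `ρ̄` surjective), the
existence of a package `(K, E^{(d)})` for which the PRODUCT of the two-variable Greenberg characteristic ideals
`ch(X_Gr(E/K_∞)) · ch(X_Gr(E^{(d)}/K_∞))`, read in `𝒪_{ℂ_p}⟦T₁,T₂⟧`, lies in `(G · G')` up to a non-zero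
cyclotomic-variable factor `s` — with NO square-free-conductor and NO (spl) hypothesis.

This file proves the FIRST RUNG of that statement one notch below K1 (the J pre-reading's RUNG-A,
tribunal-bsd 2026-08-27T05:31:57Z): in the regime of Burungale–Skinner–Tian–Wan Thm. 9.24 — `N = N_E`
square-free, `p ∤ 2N`, `(N, D_K) = 1`, (ord), (irr_K), (spl) — the SAME product conclusion holds for EVERY
admissible datum `(K, v, v̄, κ₁, κ₂, γ₁, γ₂, f, d, W', f')`, granted the two explicitly OPEN binders of the
tree's transcription of Thm. 9.24 (first clause for `f = f_E`, twist clause for `f' = f_{E^{(d)}}`), BY NAME: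
`thm924_greenberg_dvd_charIdealXGr₂_awayFromCyc_OPEN`, `thm924_twist_greenberg_dvd_charIdealXGr₂_awayFromCyc_OPEN`
(module `Literature.NumberTheory.EllipticCurves.BurungaleSkinnerTianWan2024.GreenbergMainStatementOPEN`,
claim-tagged, under review — hypotheses here, never facts). The proof is the ideal algebra
`(s₁)(s₂)·A·B ⊆ (G)(G') = (G·G')` with `s = s₁ s₂ ≠ 0` (`𝒪_{ℂ_p}⟦T⟧` is a domain).

Why it is a witness of weakness and not S: the rung regime (square-free `N`) is DISJOINT from the leaf
`WAllCornerX7` (which requires an additive prime, `¬ N` square-free) — it is the semistable shadow of the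
route's lever (the product/twist-pair packaging), decided modulo named print, while K1 itself (additive
conductor, no (spl)) is not in print. Pure bookkeeping over the tree's currency; asserts nothing about any curve.

File with: `ledger propose --kind proof --target
  Summits/BirchSwinnertonDyer/BirchSwinnertonDyer/Theorems/SignedBaseChangeK1Rung.lean --file <this>
  --supports stmt-BirchSwinnertonDyer-20249`.
-/

set_option autoImplicit false

namespace Summit.BirchSwinnertonDyer.BirchSwinnertonDyer.Theorems.SignedBaseChangeK1Rung

open PowerSeries NumberField IsDedekindDomain Field CongruenceSubgroup
  Literature.NumberTheory.GaloisRepresentations Literature.NumberTheory.EllipticCurves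
  Literature.NumberTheory.EllipticCurves.ModularForms
  Literature.NumberTheory.EllipticCurves.BurungaleSkinnerTianWan2024
  Literature.NumberTheory.EllipticCurves.IwasawaAlgebra₂

/-- Ideal algebra of the rung: two localised one-factor inclusions multiply to the localised product
inclusion, with the product witness. -/
theorem span_C_mul_mul_le_of_le {p : ℕ} [Fact p.Prime]
    {A B : Ideal (PowerSeries (PowerSeries (PadicComplexInt p)))}
    {G G' : PowerSeries (PowerSeries (PadicComplexInt p))} {s₁ s₂ : PowerSeries (PadicComplexInt p)}
    (hA : Ideal.span {PowerSeries.map (PowerSeries.C (R := PadicComplexInt p)) s₁} * A ≤ Ideal.span {G})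
    (hB : Ideal.span {PowerSeries.map (PowerSeries.C (R := PadicComplexInt p)) s₂} * B ≤ Ideal.span {G'}) :
    Ideal.span {PowerSeries.map (PowerSeries.C (R := PadicComplexInt p)) (s₁ * s₂)} * (A * B) ≤
      Ideal.span {G * G'} := by
  rw [map_mul, ← Ideal.span_singleton_mul_span_singleton, ← Ideal.span_singleton_mul_span_singleton,
    mul_mul_mul_comm]
  exact Ideal.mul_mono hA hB

/-- **RUNG-A (K1 in the BSTW Thm. 9.24 regime, BY NAME).** Granted the two OPEN binders of the tree's
transcription of Burungale–Skinner–Tian–Wan Thm. 9.24 (first clause and twist clause), for every globally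
minimal `W/ℚ` with square-free conductor `N`, every prime `p ∤ 2N`, every imaginary quadratic `K` with
(ord), `(N, D_K) = 1`, (irr_K), (spl), the cyclotomic/anticyclotomic tower with a generator pair, every
square-free `d ≠ 1` ramified only at primes `q ≠ p`, `q ∤ N`, a globally minimal model `W'` of `E^{(d)}` with
newform `f'`, every Katz frame `LK` and Greenberg frames `G` of `f`, `G'` of `f'`, and every compatible `J`:
some non-zero cyclotomic-variable `s` has `s · ch(X_Gr(E/K_∞)) · ch(X_Gr(E^{(d)}/K_∞)) ⊆ (G · G')` in
`𝒪_{ℂ_p}⟦T₁,T₂⟧` — the conclusion of K1 (`TwistPairGreenbergProductDivisibility`) verbatim, in the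
semistable sibling regime. -/
theorem twistPairProduct_of_thm924
    (h₁ : thm924_greenberg_dvd_charIdealXGr₂_awayFromCyc_OPEN)
    (h₂ : thm924_twist_greenberg_dvd_charIdealXGr₂_awayFromCyc_OPEN)
    {p : ℕ} [Fact p.Prime] (ι : PadicAlgCl p ≃+* ℂ) (W W' : WeierstrassCurve ℚ) [W.IsElliptic]
    [W.IsGloballyMinimal] [W'.IsElliptic] [W'.IsGloballyMinimal] (d : ℤ)
    (C : WeierstrassCurve.VariableChange ℚ) (K : Type) [Field K] [NumberField K]
    (v vbar : HeightOneSpectrum (𝓞 K)) (κ₁ κ₂ : ZpExtension K p) (γ₁ γ₂ : absoluteGaloisGroup K)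
    [Fact (ZpExtension.IsTopGeneratorPair κ₁ κ₂ γ₁ γ₂)] {N N' : ℕ} [NeZero N] [NeZero N']
    {f : CuspForm (Gamma0 N) 2} {f' : CuspForm (Gamma0 N') 2} (hf : IsNewformOf W f)
    (hf' : IsNewformOf W' f') [NeZero (NumberField.discr K).natAbs]
    (hN : (N : ℤ) = W.conductorNorm ℤ) (hsqN : Squarefree N) (hp2 : p ≠ 2) (hpN : ¬ p ∣ N)
    (hN' : (N' : ℤ) = W'.conductorNorm ℤ)
    (hsqd : Squarefree d) (hd1 : d ≠ 1)
    (hram : ∀ (q : ℕ) [Fact q.Prime], RamifiedInQuadratic d q → q ≠ p ∧ ¬ q ∣ N)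
    (htw : C • W' = W.quadraticTwist (d : ℚ))
    (hK : IsImaginaryQuadratic K) (hsplit : ((Ideal.span {(p : ℤ)}).primesOver (𝓞 K)).ncard = 2)
    (hv : ((p : ℕ) : 𝓞 K) ∈ v.asIdeal) (hvbar : ((p : ℕ) : 𝓞 K) ∈ vbar.asIdeal) (hvv : vbar ≠ v)
    (hι : ∀ (w : InfinitePlace K) (k : 𝓞 K), k ∈ v.asIdeal ↔ ‖ι.symm (w.embedding (k : K))‖ < 1)
    (hcop : IsCoprime (N : ℤ) (NumberField.discr K))
    (hirr : ∀ ρ : ModPGaloisRep K (ZMod p) 2, (W.baseChange K).IsTorsionGaloisRep p ρ →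
      FramedRep.IsAbsolutelyIrreducible ρ)
    (hspl : ∃ q : ℕ, q.Prime ∧ q ∣ N ∧ ((Ideal.span {(q : ℤ)}).primesOver (𝓞 K)).ncard ≠ 2)
    (h2 : ((Ideal.span {(2 : ℤ)}).primesOver (𝓞 K)).ncard = 2 ∨ 2 ∣ N)
    (hκ₁ : κ₁.IsCyclotomic) (hκ₂ : κ₂.IsAnticyclotomic)
    (Ω δ : ℂ) (Ωp : (unrIntegers p)ˣ) (LK G G' : PowerSeries (PowerSeries (PadicComplexInt p)))
    (hΩ : Ω ≠ 0) (hδ : δ ^ 2 = (NumberField.discr K : ℂ) ∨ δ ^ 2 = -(NumberField.discr K : ℂ))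
    (hLK : IsKatzMeasure₂ ι v vbar ∅ κ₁ κ₂ γ₁⁻¹ γ₂⁻¹ 1 Ω δ ((Ωp : unrIntegers p) : ℂ_[p]) LK)
    (hG : IsGreenbergLFunctionAnyRoot₂ ι v vbar κ₁ κ₂ γ₁⁻¹ γ₂⁻¹ f (NumberField.discr K).natAbs
      (NumberField.classNumber K) LK G)
    (hG' : IsGreenbergLFunctionAnyRoot₂ ι v vbar κ₁ κ₂ γ₁⁻¹ γ₂⁻¹ f' (NumberField.discr K).natAbs
      (NumberField.classNumber K) LK G')
    (J : ℤ_[p] →+* PadicComplexInt p)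
    (hJ : ∀ x : ℤ_[p], ((J x : PadicComplexInt p) : ℂ_[p]) = ((x : ℚ_[p]) : ℂ_[p])) :
    ∃ s : PowerSeries (PadicComplexInt p), s ≠ 0 ∧
      Ideal.span {PowerSeries.map (PowerSeries.C (R := PadicComplexInt p)) s} *
          ((WeierstrassCurve.XGr₂.charIdeal (W.baseChange K) p κ₁ κ₂ vbar γ₁ γ₂).map (toUnr₂ p J) *
            (WeierstrassCurve.XGr₂.charIdeal (W'.baseChange K) p κ₁ κ₂ vbar γ₁ γ₂).map (toUnr₂ p J)) ≤
        Ideal.span {G * G'} := by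
  obtain ⟨s₁, hs₁, hA⟩ := h₁ ι W K v vbar κ₁ κ₂ γ₁ γ₂ hf hN hsqN hp2 hpN hK hsplit hv hvbar hvv hι hcop
    hirr hspl h2 hκ₁ hκ₂ Ω δ Ωp LK G hΩ hδ hLK hG J hJ
  obtain ⟨s₂, hs₂, hB⟩ := h₂ ι W W' d C K v vbar κ₁ κ₂ γ₁ γ₂ hf' hN hsqN hp2 hpN hN' hsqd hd1 hram htw
    hK hsplit hv hvbar hvv hι hcop hirr hspl h2 hκ₁ hκ₂ Ω δ Ωp LK G' hΩ hδ hLK hG' J hJ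
  exact ⟨s₁ * s₂, mul_ne_zero hs₁ hs₂, span_C_mul_mul_le_of_le hA hB⟩

end Summit.BirchSwinnertonDyer.BirchSwinnertonDyer.Theorems.SignedBaseChangeK1Rung
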